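import Literature.AlgebraicGeometry.ComplexMultiplication.EndomorphismFieldHarrisTaylorSignatureReflexFieldCompositum
import Literature.NumberTheory.ComplexMultiplication.CMTypeSubfieldTracesReflexField
import HarnessLib

/-!
# The field `ℚ(tr(ι(a) ∣ Lie A) ∣ a ∈ K₀)` of Shimura's pair `(A, ι : F → End⁰A)` over a subfield `K₀ ≤ F`: Kottwitz's reflex field
# of the datum `(B = K₀, V = H₁(A, ℚ))` («the field of definition of the isomorphism class of `V₁ = Lie A`»), contained in
# `K*`; for a CM point of the Rapoport–Smithling–Zhang moduli problem (Kottwitz condition of signature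
# `((1, n−1)_{φ₀}, (0, n)_{φ ∈ Φ₀ ∖ {φ₀}})` on `Lie A`, `n = [F : K₀] ≥ 3`, `F` CM) it IS the reflex field `E = E_{Φ₀} · φ₀(K₀)`

Topic `Literature/AlgebraicGeometry/ComplexMultiplication` (family `hodge`, lane `lit-hodgefound`; the ALGEBRAIC carrier
`Motives.AbelianVariety ℂ`, Shimura's pairs `(A, ι : F →+* A.endAlgebra)`, `[F : ℚ] = 2 dim A`, THE type `Φ = cmTypeOfPair ι hF`).
Seat `lit-hodgefound-p11`, generation 28, row g28-#6: the pair-level reading of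
`NumberTheory/ComplexMultiplication/CMTypeSubfieldTracesReflexField` (g28-#5: `ℚ(tr_Φ(a) ∣ a ∈ k₀)` is Kottwitz's reflex field of the
`k₀`-signature and equals `E` under the Kottwitz condition) through g27-#2's `trace_lieAction_eq_cmTypeTrace` («`tr(ι(a) ∣ Lie A) =
tr_Φ(a)`») and g27-#5's `forall_charpoly_lieAction_eq_rsz_iff` (RSZ's displayed condition ⟺ the multiplicities).  THEOREMS ONLY
(D-0026); the field is WRITTEN OUT as
`IntermediateField.adjoin ℚ (Set.range fun a : K₀ => LinearMap.trace ℂ _ (Motives.AbelianVariety.lieAction A (ι (algebraMap K₀ F a))))`.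

PRINTED STATEMENTS.  R. E. Kottwitz (1992) [Kottwitz1992] §5 pp. 389–390: «Decompose the `B_ℂ`-module `V_ℂ` as `V_ℂ = V₁ ⊕ V₂`,
where `V₁` (respectively, `V₂`) is the subspace of `V_ℂ` on which `h(z)` acts by `z` (respectively, by `z̄`) […] Let `E ⊂ ℂ` be
the field of definition of the isomorphism class of the complex representation `V₁` of `B`; the number field `E` is called the
reflex field» — for `B = K₀ ⊆ F ⊆ End⁰(A)` and `V = H₁(A, ℚ)`, `V₁ = Lie(A)` with `tr(a ∣ V₁) = tr(ι(a) ∣ Lie A)`.  M. Rapoport,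
B. Smithling, W. Zhang [RapoportSmithlingZhang2017] arXiv:1710.06962v3 §3.1 p. 9 eq. (3.1) (`Aut(ℂ/E) = {σ ∣ σΦ = Φ, σφ₀ = φ₀}`),
§3.2 p. 10 (the moduli problem over `Spec E`: «`ι : F → End⁰(A)` […] satisfying the Kottwitz condition of signature
`((1, n−1)_{φ₀}, (0, n)_{φ ∈ Φ ∖ {φ₀}})`, i.e. `char(ι(a) ∣ Lie A) = (T − φ₀(a))(T − φ̄₀(a))^{n−1} ∏_{φ ∈ Φ ∖ {φ₀}} (T − φ̄(a))ⁿ`»),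
Introduction p. 2 («the composite of the reflex field of `r` and the reflex field of `Φ`»).  G. Shimura (1998) [Shimura1998]
§5.2 p. 39, §8.3 Prop. 28.  M. Harris, R. Taylor (2001) [HarrisTaylor2001] Lemma III.1.2 (compatibility through
`tr(b ∣ Lie A)`).  S. Lang [Lang2002] VIII §1.

WHAT IS PROVED (`K₀ : IntermediateField ℚ F`; `m_ψ = #{σ ∈ Φ ∣ σ|_{K₀} = ψ}` as `Fintype.card`, as in g27-#5):

§1 (any pair) `adjoin_trace_lieAction_eq_adjoin_cmTypeTrace` (`ℚ(tr(ι ∣ Lie A)|_{K₀}) = ℚ(tr_Φ(K₀))`),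
   `adjoin_trace_lieAction_le_traceField` (`⊆ K*`), **`forall_mem_adjoin_trace_lieAction_iff`** (`Aut(ℂ/ℚ(tr(ι ∣ Lie A)|_{K₀})) = Stab(m)`:
   Kottwitz's «field of definition» for `V₁ = Lie A`), `mem_adjoin_trace_lieAction_iff_forall`, `finiteDimensional_adjoin_trace_lieAction`,
   `finrank_adjoin_trace_lieAction_dvd` (`∣ [K* : ℚ]`).
§2 (`F` CM, RSZ's displayed condition `h` relative to `(Φ₀, φ₀)`, `n ≥ 3`) **`adjoin_trace_lieAction_eq_of_rsz`** — THE REFLEX FIELD `E` OF THE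
   SHIMURA DATUM IS GENERATED BY THE TRACES `tr(ι(a) ∣ Lie A)`, `a ∈ K₀`, OF ANY CM POINT: `ℚ(tr(ι(a) ∣ Lie A) ∣ a ∈ K₀) = E_{Φ₀} · φ₀(K₀)`;
   `adjoin_trace_lieAction_sup_eq_of_rsz` (any `n`: `· E_{Φ₀} = E`), `apply_mem_adjoin_trace_lieAction_of_rsz` (`φ₀(a) ∈ ℚ(tr ∣ K₀)`),
   and via the Harris–Taylor multiplicities `exists_cmType_adjoin_trace_lieAction_eq_of_harrisTaylor`; with g28-#3
   (`K* = E_{Φ₀} · σ₀(F)`) the inclusion `ℚ(tr(ι ∣ Lie A)|_{K₀}) ⊆ ℚ(tr(ι ∣ Lie A)|_{F}) = K*` of §1 reads `E ⊆ K*`.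

## References
* [Kottwitz1992] R. E. Kottwitz, *Points on some Shimura varieties over finite fields*, JAMS 5 (1992), §5 pp. 389–390.
* [RapoportSmithlingZhang2017] M. Rapoport, B. Smithling, W. Zhang, Compositio Math. 156 (2020); arXiv:1710.06962v3 §3.1 eq. (3.1),
  §3.2 p. 10, Introduction p. 2.
* [Shimura1998] G. Shimura, *Abelian Varieties with Complex Multiplication and Modular Functions* (1998), §5.2 p. 39, §8.3 Prop. 28.
* [HarrisTaylor2001] M. Harris, R. Taylor (2001), Lemma III.1.2.
* [Lang2002] S. Lang, *Algebra* (2002), VIII §1.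

## Provenance

Lane `lit-hodgefound` (HOME `run/shared/lean/pub/lit-hodgefound/`), prover seat `lit-hodgefound-p11` (gen 28), self-proposed row
g28-#6 (INBOX claim 2026-08-27), pair-level companion of g28-#5.
-/

noncomputable section

namespace Literature.AlgebraicGeometry.ComplexMultiplication

open scoped Classical Polynomial Pointwise
open CategoryTheory NumberField Module Polynomial
open Literature.AlgebraicGeometry.Motives
open Literature.NumberTheory.ComplexMultiplication

namespace EndFieldFullDegree

variable {F : Type} [Field F] [NumberField F] {A : AbelianVariety ℂ}
  (ιF : F →+* A.endAlgebra) (hF : finrank ℚ F = 2 * A.dim) (K₀ : IntermediateField ℚ F)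

/-! ### §0 Dictionary -/

/-- The multiplicity `m_ψ` of THE type as a set cardinality. [folklore] -/
private theorem ncard_inter_fibre_eq_card_fibre_lt (ψ : K₀ →+* ℂ) :
    {φ : F →+* ℂ | φ ∈ (cmTypeOfPair ιF hF).1 ∧ φ.comp (algebraMap K₀ F) = ψ}.ncard =
      Fintype.card {σ : (cmTypeOfPair ιF hF).1 // σ.1.comp (algebraMap K₀ F) = ψ} := by
  rw [← Nat.card_coe_set_eq, Fintype.card_eq_nat_card]
  exact Nat.card_congr
    (Equiv.subtypeSubtypeEquivSubtypeInter (fun φ : F →+* ℂ => φ ∈ (cmTypeOfPair ιF hF).1)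
      (fun φ => φ.comp (algebraMap K₀ F) = ψ)).symm

/-- A subfield of a number field inside `ℂ` is a number field. [folklore] -/
private theorem finiteDimensional_of_le_lt {E E' : IntermediateField ℚ ℂ} [FiniteDimensional ℚ E] (h : E' ≤ E) :
    FiniteDimensional ℚ E' :=
  FiniteDimensional.of_injective (IntermediateField.inclusion h).toLinearMap (IntermediateField.inclusion_injective h)

/-- `K*` is finite over `ℚ`. [folklore] -/
private theorem finiteDimensional_traceField_lt {E : Type} [Field E] [NumberField E] (Ψ : CMType E) :
    FiniteDimensional ℚ (traceField Ψ) :=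
  Module.finite_of_finrank_pos (finrank_traceField_pos Ψ)

/-! ### §1 `ℚ(tr(ι(a) ∣ Lie A) ∣ a ∈ K₀)` for any pair -/

/-- **`ℚ(tr(ι(a) ∣ Lie A) ∣ a ∈ K₀) = ℚ(tr_Φ(a) ∣ a ∈ K₀)`** (`tr(ι(a) ∣ Lie A) = tr_Φ(a)`, g27-#2). [cite: Shimura1998, §5.2 p. 39]
[cite: Kottwitz1992, §5 p. 390] -/
theorem adjoin_trace_lieAction_eq_adjoin_cmTypeTrace :
    IntermediateField.adjoin ℚ (Set.range fun a : K₀ =>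
        LinearMap.trace ℂ _ (Motives.AbelianVariety.lieAction A (ιF (algebraMap K₀ F a)))) =
      IntermediateField.adjoin ℚ (Set.range fun a : K₀ => cmTypeTrace (cmTypeOfPair ιF hF) (algebraMap K₀ F a)) := by
  have h : (fun a : K₀ => LinearMap.trace ℂ _ (Motives.AbelianVariety.lieAction A (ιF (algebraMap K₀ F a)))) =
      fun a : K₀ => cmTypeTrace (cmTypeOfPair ιF hF) (algebraMap K₀ F a) :=
    funext fun a => trace_lieAction_eq_cmTypeTrace ιF hF _
  rw [h]

/-- **`ℚ(tr(ι ∣ Lie A)|_{K₀}) ⊆ K*`.** [cite: Shimura1998, §8.3 Prop. 28] -/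
theorem adjoin_trace_lieAction_le_traceField :
    IntermediateField.adjoin ℚ (Set.range fun a : K₀ =>
        LinearMap.trace ℂ _ (Motives.AbelianVariety.lieAction A (ιF (algebraMap K₀ F a)))) ≤ traceField (cmTypeOfPair ιF hF) := by
  rw [adjoin_trace_lieAction_eq_adjoin_cmTypeTrace ιF hF K₀]
  exact adjoin_cmTypeTrace_algebraMap_le_traceField K₀ _

/-- **KOTTWITZ'S REFLEX FIELD OF `(K₀, H₁(A, ℚ))`: `Aut(ℂ/ℚ(tr(ι ∣ Lie A)|_{K₀})) = Stab(m)`** — an automorphism of `ℂ` fixes every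
`tr(ι(a) ∣ Lie A)`, `a ∈ K₀`, iff it preserves the multiplicities `m_ψ` of `Lie A ≅ ⊕_ψ ψ^{m_ψ}` as a `K₀ ⊗ ℂ`-module («the field of
definition of the isomorphism class of the complex representation `V₁`»). [cite: Kottwitz1992, §5 pp. 389–390]
[cite: HarrisTaylor2001, Lemma III.1.2] -/
theorem forall_mem_adjoin_trace_lieAction_iff (τ : ℂ ≃+* ℂ) :
    (∀ z : ℂ, z ∈ IntermediateField.adjoin ℚ (Set.range fun a : K₀ =>
        LinearMap.trace ℂ _ (Motives.AbelianVariety.lieAction A (ιF (algebraMap K₀ F a)))) → τ z = z) ↔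
      ∀ ψ : K₀ →+* ℂ, Fintype.card {σ : (cmTypeOfPair ιF hF).1 // σ.1.comp (algebraMap K₀ F) = τ • ψ} =
        Fintype.card {σ : (cmTypeOfPair ιF hF).1 // σ.1.comp (algebraMap K₀ F) = ψ} := by
  rw [adjoin_trace_lieAction_eq_adjoin_cmTypeTrace ιF hF K₀, forall_mem_adjoin_cmTypeTrace_algebraMap_iff]
  simp only [ncard_inter_fibre_eq_card_fibre_lt ιF hF K₀]

/-- **`ℚ(tr(ι ∣ Lie A)|_{K₀})` is the fixed field of `Stab(m)`.** [cite: Kottwitz1992, §5 pp. 389–390] [cite: Lang2002, Ch. VIII §1] -/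
theorem mem_adjoin_trace_lieAction_iff_forall (z : ℂ) :
    z ∈ IntermediateField.adjoin ℚ (Set.range fun a : K₀ =>
        LinearMap.trace ℂ _ (Motives.AbelianVariety.lieAction A (ιF (algebraMap K₀ F a)))) ↔
      ∀ τ : ℂ ≃+* ℂ, (∀ ψ : K₀ →+* ℂ, Fintype.card {σ : (cmTypeOfPair ιF hF).1 // σ.1.comp (algebraMap K₀ F) = τ • ψ} =
        Fintype.card {σ : (cmTypeOfPair ιF hF).1 // σ.1.comp (algebraMap K₀ F) = ψ}) → τ z = z := by
  rw [adjoin_trace_lieAction_eq_adjoin_cmTypeTrace ιF hF K₀, mem_adjoin_cmTypeTrace_algebraMap_iff_forall]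
  simp only [ncard_inter_fibre_eq_card_fibre_lt ιF hF K₀]

include hF in
/-- «the number field `E`»: `ℚ(tr(ι ∣ Lie A)|_{K₀})` is finite over `ℚ`. [cite: Kottwitz1992, §5 p. 390] -/
theorem finiteDimensional_adjoin_trace_lieAction :
    FiniteDimensional ℚ (IntermediateField.adjoin ℚ (Set.range fun a : K₀ =>
        LinearMap.trace ℂ _ (Motives.AbelianVariety.lieAction A (ιF (algebraMap K₀ F a))))) :=
  haveI := finiteDimensional_traceField_lt (cmTypeOfPair ιF hF)
  finiteDimensional_of_le_lt (adjoin_trace_lieAction_le_traceField ιF hF K₀)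

/-- `[ℚ(tr(ι ∣ Lie A)|_{K₀}) : ℚ] ∣ [K* : ℚ]`. [cite: Shimura1998, §8.3 Prop. 28] -/
theorem finrank_adjoin_trace_lieAction_dvd :
    finrank ℚ (IntermediateField.adjoin ℚ (Set.range fun a : K₀ =>
        LinearMap.trace ℂ _ (Motives.AbelianVariety.lieAction A (ιF (algebraMap K₀ F a))))) ∣
      finrank ℚ (traceField (cmTypeOfPair ιF hF)) := by
  rw [adjoin_trace_lieAction_eq_adjoin_cmTypeTrace ιF hF K₀]
  exact finrank_adjoin_cmTypeTrace_algebraMap_dvd K₀ _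

/-! ### §2 CM points of RSZ's moduli problem: `ℚ(tr(ι(a) ∣ Lie A) ∣ a ∈ K₀) = E` -/

section RSZ

variable [IsCMField F] (Φ₀ : CMType K₀) {φ₀ : K₀ →+* ℂ} (hφ₀ : φ₀ ∈ Φ₀.1)
  (h : ∀ a : K₀, (Motives.AbelianVariety.lieAction A (ιF (algebraMap K₀ F a))).charpoly =
    (X - C (φ₀ a : ℂ)) * ((X - C (ComplexEmbedding.conjugate φ₀ a : ℂ)) ^ (finrank K₀ F - 1) *
      ∏ φ ∈ Φ₀.1.toFinset.erase φ₀, (X - C (ComplexEmbedding.conjugate φ a : ℂ)) ^ finrank K₀ F))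

omit [IsCMField F] in
include hφ₀ h in
/-- RSZ's displayed condition gives `m_{φ₀} = 1` (set spelling). [cite: RapoportSmithlingZhang2017, §3.2] -/
private theorem h1_ncard_lt :
    {φ : F →+* ℂ | φ ∈ (cmTypeOfPair ιF hF).1 ∧ φ.comp (algebraMap K₀ F) = φ₀}.ncard = 1 := by
  rw [ncard_inter_fibre_eq_card_fibre_lt ιF hF K₀]
  exact ((forall_charpoly_lieAction_eq_rsz_iff ιF hF K₀ Φ₀ hφ₀).1 h).1

omit [IsCMField F] in
include hφ₀ h in
/-- RSZ's displayed condition gives `m_φ = 0` on `Φ₀ ∖ {φ₀}` (set spelling). [cite: RapoportSmithlingZhang2017, §3.2] -/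
private theorem hΦ₀_ncard_lt : ∀ ψ : K₀ →+* ℂ, ψ ∈ Φ₀.1 → ψ ≠ φ₀ →
    {φ : F →+* ℂ | φ ∈ (cmTypeOfPair ιF hF).1 ∧ φ.comp (algebraMap K₀ F) = ψ}.ncard = 0 := by
  intro ψ hψ hne
  rw [ncard_inter_fibre_eq_card_fibre_lt ιF hF K₀]
  exact ((forall_charpoly_lieAction_eq_rsz_iff ιF hF K₀ Φ₀ hφ₀).1 h).2 ψ hψ hne

include hφ₀ h hF in
/-- **`ℚ(tr(ι(a) ∣ Lie A) ∣ a ∈ K₀) = E_{Φ₀} · φ₀(K₀) = E`**: THE REFLEX FIELD OF THE RAPOPORT–SMITHLING–ZHANG DATUM IS THE FIELD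
GENERATED BY THE TRACES OF THE `K₀`-ACTION ON THE LIE ALGEBRA OF ANY CM POINT `(A, ι)` OF THE MODULI PROBLEM (`n = [F : K₀] ≥ 3`,
`F` CM; Kottwitz's `E` for `(B = K₀, V = H₁(A, ℚ))` agrees with RSZ's `E`). [cite: RapoportSmithlingZhang2017, §3.1 eq. (3.1) and §3.2]
[cite: Kottwitz1992, §5 pp. 389–390] [cite: Lang2002, Ch. VIII §1] -/
theorem adjoin_trace_lieAction_eq_of_rsz (h3 : 3 ≤ finrank K₀ F) :
    IntermediateField.adjoin ℚ (Set.range fun a : K₀ =>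
        LinearMap.trace ℂ _ (Motives.AbelianVariety.lieAction A (ιF (algebraMap K₀ F a)))) =
      traceField Φ₀ ⊔ φ₀.toRatAlgHom.fieldRange := by
  rw [adjoin_trace_lieAction_eq_adjoin_cmTypeTrace ιF hF K₀]
  exact adjoin_cmTypeTrace_algebraMap_eq_of_rsz K₀ hφ₀ (h1_ncard_lt ιF hF K₀ Φ₀ hφ₀ h) (hΦ₀_ncard_lt ιF hF K₀ Φ₀ hφ₀ h) h3

include hφ₀ h hF in
/-- Any `n`: **`ℚ(tr(ι ∣ Lie A)|_{K₀}) · E_{Φ₀} = E`** («the composite of the reflex field of `r` and the reflex field of `Φ`»).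
[cite: RapoportSmithlingZhang2017, Introduction p. 2] [cite: RapoportSmithlingZhang2017, §3.1 eq. (3.1)] -/
theorem adjoin_trace_lieAction_sup_eq_of_rsz :
    IntermediateField.adjoin ℚ (Set.range fun a : K₀ =>
        LinearMap.trace ℂ _ (Motives.AbelianVariety.lieAction A (ιF (algebraMap K₀ F a)))) ⊔ traceField Φ₀ =
      traceField Φ₀ ⊔ φ₀.toRatAlgHom.fieldRange := by
  rw [adjoin_trace_lieAction_eq_adjoin_cmTypeTrace ιF hF K₀]
  exact adjoin_cmTypeTrace_algebraMap_sup_eq_of_rsz K₀ hφ₀ (h1_ncard_lt ιF hF K₀ Φ₀ hφ₀ h) (hΦ₀_ncard_lt ιF hF K₀ Φ₀ hφ₀ h)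

include hφ₀ h hF in
/-- `n ≥ 3`: **`φ₀(a) ∈ ℚ(tr(ι ∣ Lie A)|_{K₀})`** — the distinguished embedding is a rational function of the Lie-algebra traces.
[cite: RapoportSmithlingZhang2017, §3.1 (after eq. (3.1))] -/
theorem apply_mem_adjoin_trace_lieAction_of_rsz (h3 : 3 ≤ finrank K₀ F) (a : K₀) :
    φ₀ a ∈ IntermediateField.adjoin ℚ (Set.range fun x : K₀ =>
        LinearMap.trace ℂ _ (Motives.AbelianVariety.lieAction A (ιF (algebraMap K₀ F x)))) := by
  rw [adjoin_trace_lieAction_eq_of_rsz ιF hF K₀ Φ₀ hφ₀ h h3]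
  exact apply_mem_traceField_sup_fieldRange Φ₀ φ₀ a

include hφ₀ h hF in
/-- `n ≥ 3`: **`E_{Φ₀} ⊆ ℚ(tr(ι ∣ Lie A)|_{K₀})`**. [cite: RapoportSmithlingZhang2017, §3.1 Remark 3.1 (i)] -/
theorem traceField_base_le_adjoin_trace_lieAction_of_rsz (h3 : 3 ≤ finrank K₀ F) :
    traceField Φ₀ ≤ IntermediateField.adjoin ℚ (Set.range fun x : K₀ =>
        LinearMap.trace ℂ _ (Motives.AbelianVariety.lieAction A (ιF (algebraMap K₀ F x)))) := by
  rw [adjoin_trace_lieAction_eq_of_rsz ιF hF K₀ Φ₀ hφ₀ h h3]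
  exact le_sup_left

end RSZ

/-! ### §3 Through the Harris–Taylor multiplicities -/

section HarrisTaylor

variable [IsCMField F] {φ₀ : K₀ →+* ℂ}
  (h1 : Fintype.card {σ : (cmTypeOfPair ιF hF).1 // σ.1.comp (algebraMap K₀ F) = φ₀} = 1)
  (hban : ∀ ψ : K₀ →+* ℂ, ψ ≠ φ₀ → ψ ≠ ComplexEmbedding.conjugate φ₀ →
    Fintype.card {σ : (cmTypeOfPair ιF hF).1 // σ.1.comp (algebraMap K₀ F) = ψ} = 0 ∨
      Fintype.card {σ : (cmTypeOfPair ιF hF).1 // σ.1.comp (algebraMap K₀ F) = ψ} = finrank K₀ F)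

omit [IsCMField F] in
include h1 in
/-- `h1` in the field-level spelling. [folklore] -/
private theorem h1_ncard_lt' : {φ : F →+* ℂ | φ ∈ (cmTypeOfPair ιF hF).1 ∧ φ.comp (algebraMap K₀ F) = φ₀}.ncard = 1 := by
  rw [ncard_inter_fibre_eq_card_fibre_lt ιF hF K₀, h1]

omit [IsCMField F] in
include hban in
/-- `hban` in the field-level spelling. [folklore] -/
private theorem hban_ncard_lt' : ∀ ψ : K₀ →+* ℂ, ψ ≠ φ₀ → ψ ≠ ComplexEmbedding.conjugate φ₀ →
    {φ : F →+* ℂ | φ ∈ (cmTypeOfPair ιF hF).1 ∧ φ.comp (algebraMap K₀ F) = ψ}.ncard = 0 ∨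
      {φ : F →+* ℂ | φ ∈ (cmTypeOfPair ιF hF).1 ∧ φ.comp (algebraMap K₀ F) = ψ}.ncard = finrank K₀ F := by
  intro ψ hψ0 hψ1
  rw [ncard_inter_fibre_eq_card_fibre_lt ιF hF K₀]
  exact hban ψ hψ0 hψ1

include h1 hban hF in
/-- **A CM point with the Harris–Taylor multiplicities (`m_{φ₀} = 1`, `m_ψ ∈ {0, n}` off `{φ₀, φ̄₀}`; `n ≥ 3`) has a base type `Φ₀ ∋ φ₀`
with `ℚ(tr(ι(a) ∣ Lie A) ∣ a ∈ K₀) = E_{Φ₀} · φ₀(K₀)`.** [cite: RapoportSmithlingZhang2017, §3.1 eq. (3.1)] [cite: Howard2012, §3.1] -/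
theorem exists_cmType_adjoin_trace_lieAction_eq_of_harrisTaylor (h3 : 3 ≤ finrank K₀ F) :
    ∃ Φ₀ : CMType K₀, φ₀ ∈ Φ₀.1 ∧
      IntermediateField.adjoin ℚ (Set.range fun a : K₀ =>
          LinearMap.trace ℂ _ (Motives.AbelianVariety.lieAction A (ιF (algebraMap K₀ F a)))) =
        traceField Φ₀ ⊔ φ₀.toRatAlgHom.fieldRange := by
  rw [adjoin_trace_lieAction_eq_adjoin_cmTypeTrace ιF hF K₀]
  exact exists_cmType_adjoin_cmTypeTrace_algebraMap_eq_of_harrisTaylor K₀ (h1_ncard_lt' ιF hF K₀ h1)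
    (hban_ncard_lt' ιF hF K₀ hban) h3

include h1 hban hF in
/-- `n ≥ 3`: **`φ₀(K₀) ⊆ ℚ(tr(ι ∣ Lie A)|_{K₀})`** under the Harris–Taylor multiplicities. [cite: RapoportSmithlingZhang2017, §3.1 (after eq. (3.1))] -/
theorem fieldRange_le_adjoin_trace_lieAction_of_harrisTaylor (h3 : 3 ≤ finrank K₀ F) :
    φ₀.toRatAlgHom.fieldRange ≤ IntermediateField.adjoin ℚ (Set.range fun x : K₀ =>
        LinearMap.trace ℂ _ (Motives.AbelianVariety.lieAction A (ιF (algebraMap K₀ F x)))) := by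
  rw [adjoin_trace_lieAction_eq_adjoin_cmTypeTrace ιF hF K₀]
  exact fieldRange_le_adjoin_cmTypeTrace_algebraMap_of_harrisTaylor K₀ (h1_ncard_lt' ιF hF K₀ h1) (hban_ncard_lt' ιF hF K₀ hban) h3

include h1 hban hF in
/-- `n ≥ 3`: **`[K₀ : ℚ] ∣ [ℚ(tr(ι ∣ Lie A)|_{K₀}) : ℚ]`**. [cite: MilneFT2022, Prop. 1.20] -/
theorem finrank_dvd_finrank_adjoin_trace_lieAction_of_harrisTaylor (h3 : 3 ≤ finrank K₀ F) :
    finrank ℚ K₀ ∣ finrank ℚ (IntermediateField.adjoin ℚ (Set.range fun x : K₀ =>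
        LinearMap.trace ℂ _ (Motives.AbelianVariety.lieAction A (ιF (algebraMap K₀ F x))))) := by
  rw [adjoin_trace_lieAction_eq_adjoin_cmTypeTrace ιF hF K₀]
  exact finrank_dvd_finrank_adjoin_cmTypeTrace_algebraMap_of_harrisTaylor K₀ (h1_ncard_lt' ιF hF K₀ h1)
    (hban_ncard_lt' ιF hF K₀ hban) h3

end HarrisTaylor

end EndFieldFullDegree

end Literature.AlgebraicGeometry.ComplexMultiplication

end
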